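import Mathlib

/-!
# Definitions: the open Hessenberg four-band pencil `HB_n` (crux `ValuativeGCT.ValuativeFlip`,
# stmt-ValiantsHypothesis-12624, line `four-row-count`, heart stub `stub_fourRowPencilRank`)

Wall-breaker k1 gen 1 (`Cruxes/ValuativeFlip/AxisK1G1HessenbergPencil.md`).  The `m`-free form `H` of the heart stub
(`fourRowPencilRank_of_pencilCertificate`) asks for ONE explicit pencil `M : Fin n × Fin n → Fin 4 → ℂ` per `n` with
`T(n) ≤ finrank span{X_t · (∂_ij per_n)(M·X)}`.  This file fixes the candidate whose rank law is `3n² − n − O(1)`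
(numerically `≥ T(n)` from `n = 40`; inductive proof architecture with landed engine
`Theorems/ValuativeGCTValuativeFlipDegenerationStep.lean`, structure `…HessenbergCofactors.lean`, recurrences
`…BorderRecurrences.lean`):

* `hbPencil a b c d n` — the pencil with four diagonals and ONE VARIABLE PER DIAGONAL (0-indexed rows `r`):
  cell `(r, r−1)` carries `c r · y₀`, `(r, r)` carries `a r · y₁`, `(r, r+1)` carries `b r · y₂`, `(r, r+2)` carries
  `d r · y₃`, every other cell `0`; the weights are sequences `ℕ → ℂ` so that `HB_n` is literally the top-left block
  of `HB_{n+1}` (`hbPencil_castSucc`);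
* `hbForm a b c d n q = Σ_t hbPencil … q t • X t` — the corresponding point of the generic matrix with values in
  `MvPolynomial (Fin 4) ℂ` (the substitution of `H`);
* the structural facts every general lemma of the programme consumes: values on and off the band
  (`hbForm_apply_*`), lower bandwidth one (`hbForm_eq_zero_of_lt`), the sparse border (`hbForm_lastCol_eq_zero`,
  `hbForm_lastRow_eq_zero`), restriction to the top-left block (`hbForm_castSucc`), and the invertible coordinate
  minor on the cells `(1,0),(0,0),(0,1),(0,2)` (`hbPencil_coordMinor_isUnit`).
Definitions plus elementary lemmas about them; no mathematics beyond unfolding. [this crux; new]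
-/

set_option linter.dupNamespace false

namespace Summit.ValiantsHypothesis.ValiantsHypothesis.Theorems.ValuativeFlip

open MvPolynomial
open scoped BigOperators

noncomputable section

/-- The open Hessenberg four-band pencil `HB_n` with weight sequences `a b c d : ℕ → ℂ` (0-indexed rows):
the coefficient of `y_t = X t` in cell `q = (r, s)` is `c r` if `s + 1 = r ∧ t = 0`, `a r` if `r = s ∧ t = 1`,
`b r` if `r + 1 = s ∧ t = 2`, `d r` if `r + 2 = s ∧ t = 3`, and `0` otherwise — in the format
`Fin n × Fin n → Fin 4 → ℂ` of `fourRowPencilRank_of_pencilCertificate`. [this crux] -/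
def hbPencil (a b c d : ℕ → ℂ) (n : ℕ) : Fin n × Fin n → Fin 4 → ℂ := fun q t =>
  if (q.2 : ℕ) + 1 = q.1 ∧ t = 0 then c q.1
  else if (q.1 : ℕ) = q.2 ∧ t = 1 then a q.1
  else if (q.1 : ℕ) + 1 = q.2 ∧ t = 2 then b q.1
  else if (q.1 : ℕ) + 2 = q.2 ∧ t = 3 then d q.1
  else 0

/-- The point of the generic `n × n` matrix defined by the pencil: cell `q` carries the linear form
`Σ_t hbPencil a b c d n q t • y_t` (the substitution `fun ij => ∑ t, M ij t • X t` of `H`). [this crux] -/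
def hbForm (a b c d : ℕ → ℂ) (n : ℕ) (q : Fin n × Fin n) : MvPolynomial (Fin 4) ℂ :=
  ∑ t : Fin 4, hbPencil a b c d n q t • (X t : MvPolynomial (Fin 4) ℂ)

variable (a b c d : ℕ → ℂ)

/-- Unfolding `hbForm` as the four-term sum over the diagonals. [this crux] -/
theorem hbForm_eq (n : ℕ) (q : Fin n × Fin n) :
    hbForm a b c d n q =
      (if (q.2 : ℕ) + 1 = q.1 then c q.1 • (X 0 : MvPolynomial (Fin 4) ℂ) else 0) +
      (if (q.1 : ℕ) = q.2 then a q.1 • (X 1 : MvPolynomial (Fin 4) ℂ) else 0) +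
      (if (q.1 : ℕ) + 1 = q.2 then b q.1 • (X 2 : MvPolynomial (Fin 4) ℂ) else 0) +
      (if (q.1 : ℕ) + 2 = q.2 then d q.1 • (X 3 : MvPolynomial (Fin 4) ℂ) else 0) := by
  simp only [hbForm, hbPencil, Fin.sum_univ_four, Fin.isValue, Fin.reduceEq, and_true, and_false, if_false,
    ite_smul, zero_smul]

/-- Off the four diagonals the form vanishes. [this crux] -/
theorem hbForm_apply_of_offBand (n : ℕ) (q : Fin n × Fin n) (h0 : (q.2 : ℕ) + 1 ≠ q.1) (h1 : (q.1 : ℕ) ≠ q.2)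
    (h2 : (q.1 : ℕ) + 1 ≠ q.2) (h3 : (q.1 : ℕ) + 2 ≠ q.2) : hbForm a b c d n q = 0 := by
  rw [hbForm_eq, if_neg h0, if_neg h1, if_neg h2, if_neg h3]
  simp

/-- The sub-diagonal carries `c r · y₀`. [this crux] -/
theorem hbForm_apply_sub (n : ℕ) (q : Fin n × Fin n) (h : (q.2 : ℕ) + 1 = q.1) :
    hbForm a b c d n q = c q.1 • (X 0 : MvPolynomial (Fin 4) ℂ) := by
  have h1 : ¬ ((q.1 : ℕ) = q.2) := by omega
  have h2 : ¬ ((q.1 : ℕ) + 1 = q.2) := by omega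
  have h3 : ¬ ((q.1 : ℕ) + 2 = q.2) := by omega
  rw [hbForm_eq, if_pos h, if_neg h1, if_neg h2, if_neg h3]
  simp

/-- The diagonal carries `a r · y₁`. [this crux] -/
theorem hbForm_apply_diag (n : ℕ) (q : Fin n × Fin n) (h : (q.1 : ℕ) = q.2) :
    hbForm a b c d n q = a q.1 • (X 1 : MvPolynomial (Fin 4) ℂ) := by
  have h0 : ¬ ((q.2 : ℕ) + 1 = q.1) := by omega
  have h2 : ¬ ((q.1 : ℕ) + 1 = q.2) := by omega
  have h3 : ¬ ((q.1 : ℕ) + 2 = q.2) := by omega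
  rw [hbForm_eq, if_neg h0, if_pos h, if_neg h2, if_neg h3]
  simp

/-- The first super-diagonal carries `b r · y₂`. [this crux] -/
theorem hbForm_apply_super (n : ℕ) (q : Fin n × Fin n) (h : (q.1 : ℕ) + 1 = q.2) :
    hbForm a b c d n q = b q.1 • (X 2 : MvPolynomial (Fin 4) ℂ) := by
  have h0 : ¬ ((q.2 : ℕ) + 1 = q.1) := by omega
  have h1 : ¬ ((q.1 : ℕ) = q.2) := by omega
  have h3 : ¬ ((q.1 : ℕ) + 2 = q.2) := by omega
  rw [hbForm_eq, if_neg h0, if_neg h1, if_pos h, if_neg h3]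
  simp

/-- The second super-diagonal carries `d r · y₃`. [this crux] -/
theorem hbForm_apply_super2 (n : ℕ) (q : Fin n × Fin n) (h : (q.1 : ℕ) + 2 = q.2) :
    hbForm a b c d n q = d q.1 • (X 3 : MvPolynomial (Fin 4) ℂ) := by
  have h0 : ¬ ((q.2 : ℕ) + 1 = q.1) := by omega
  have h1 : ¬ ((q.1 : ℕ) = q.2) := by omega
  have h2 : ¬ ((q.1 : ℕ) + 1 = q.2) := by omega
  rw [hbForm_eq, if_neg h0, if_neg h1, if_neg h2, if_pos h]
  simp

/-- LOWER BANDWIDTH ONE: the form vanishes strictly below the sub-diagonal (the hypothesis of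
`hb_upper_cofactor` / `hb_aeval_pderiv_perPoly_upper`). [this crux] -/
theorem hbForm_eq_zero_of_lt (n : ℕ) (r s : Fin n) (h : (s : ℕ) + 1 < r) : hbForm a b c d n (r, s) = 0 :=
  hbForm_apply_of_offBand a b c d n (r, s) (by simp; omega) (by simp; omega) (by simp; omega) (by simp; omega)

/-- SPARSE BORDER COLUMN: the last column of `HB_{n+3}` vanishes above row `n` (the hypothesis `hcol` of
`hb_lastRow_generator_two_term` / `hb_secondRow_generator_two_term`). [this crux] -/
theorem hbForm_lastCol_eq_zero (n : ℕ) (i : Fin n) :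
    hbForm a b c d (n + 3) (Fin.castSucc (Fin.castSucc (Fin.castSucc i)), Fin.last (n + 2)) = 0 :=
  hbForm_apply_of_offBand a b c d (n + 3) _ (by simp; omega) (by simp; omega) (by simp; omega) (by simp; omega)

/-- SPARSE BORDER ROW: the last row of `HB_{n+3}` vanishes left of column `n+1` (the hypothesis `hrow` of
`hb_secondRow_generator_two_term`; at `c (n+2) = 0` it vanishes off the corner, the hypothesis of the `c = 0`
identities of `…DegenerationStep.lean`). [this crux] -/
theorem hbForm_lastRow_eq_zero (n : ℕ) (j : Fin (n + 1)) :
    hbForm a b c d (n + 3) (Fin.last (n + 2), Fin.castSucc (Fin.castSucc j)) = 0 :=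
  hbForm_apply_of_offBand a b c d (n + 3) _ (by simp; omega) (by simp; omega) (by simp; omega) (by simp; omega)

/-- The last row of `HB_{n+2}`: its only entry left of the corner is the sub-diagonal one, `c (n+1) · y₀`.
[this crux] -/
theorem hbForm_lastRow_sub (n : ℕ) :
    hbForm a b c d (n + 2) (Fin.last (n + 1), Fin.castSucc (Fin.last n)) = c (n + 1) • (X 0 : MvPolynomial (Fin 4) ℂ) := by
  rw [hbForm_apply_sub a b c d (n + 2) _ (by simp)]
  simp

/-- The corner of `HB_{n+1}` is `a n · y₁`. [this crux] -/
theorem hbForm_corner (n : ℕ) :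
    hbForm a b c d (n + 1) (Fin.last n, Fin.last n) = a n • (X 1 : MvPolynomial (Fin 4) ℂ) := by
  rw [hbForm_apply_diag a b c d (n + 1) _ rfl]
  simp

/-- RESTRICTION: `HB_n` is the top-left block of `HB_{n+1}` (the weights are sequences, the band conditions only see
the numerical values of the indices). [this crux] -/
theorem hbForm_castSucc (n : ℕ) (q : Fin n × Fin n) :
    hbForm a b c d (n + 1) (Fin.castSucc q.1, Fin.castSucc q.2) = hbForm a b c d n q := by
  rw [hbForm_eq, hbForm_eq]
  simp only [Fin.val_castSucc]

/-- The same for the coefficient pencil. [this crux] -/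
theorem hbPencil_castSucc (n : ℕ) (q : Fin n × Fin n) (t : Fin 4) :
    hbPencil a b c d (n + 1) (Fin.castSucc q.1, Fin.castSucc q.2) t = hbPencil a b c d n q t := by
  simp only [hbPencil, Fin.val_castSucc]

/-- The coordinate minor of `H` on the cells `(1,0), (0,0), (0,1), (0,2)` of `HB_{n+3}` is the diagonal matrix
`diag(c 1, a 0, b 0, d 0)`. [this crux] -/
theorem hbPencil_coordMinor (n : ℕ) :
    (Matrix.of fun t t' : Fin 4 =>
      hbPencil a b c d (n + 3) (![((1 : Fin (n + 3)), (0 : Fin (n + 3))), ((0 : Fin (n + 3)), (0 : Fin (n + 3))),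
        ((0 : Fin (n + 3)), (1 : Fin (n + 3))), ((0 : Fin (n + 3)), (2 : Fin (n + 3)))] t') t) =
      Matrix.diagonal ![c 1, a 0, b 0, d 0] := by
  have h2 : (2 : ℕ) % (n + 3) = 2 := Nat.mod_eq_of_lt (by omega)
  ext t t'
  fin_cases t <;> fin_cases t' <;>
    simp [hbPencil, Matrix.diagonal, h2]

omit a b c d in
/-- Hence the coordinate minor is invertible as soon as `c 1, a 0, b 0, d 0 ≠ 0` (the `IsUnit` hypothesis of
`fourRowPencilRank_of_pencilCertificate`). [this crux] -/
theorem hbPencil_coordMinor_isUnit (a b c d : ℕ → ℂ) (n : ℕ) (hc : c 1 ≠ 0) (ha : a 0 ≠ 0) (hb : b 0 ≠ 0) (hd : d 0 ≠ 0) :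
    IsUnit (Matrix.of fun t t' : Fin 4 =>
      hbPencil a b c d (n + 3) (![((1 : Fin (n + 3)), (0 : Fin (n + 3))), ((0 : Fin (n + 3)), (0 : Fin (n + 3))),
        ((0 : Fin (n + 3)), (1 : Fin (n + 3))), ((0 : Fin (n + 3)), (2 : Fin (n + 3)))] t') t) := by
  rw [hbPencil_coordMinor, Matrix.isUnit_iff_isUnit_det, Matrix.det_diagonal]
  simp [Fin.prod_univ_four, hc, ha, hb, hd]

end

end Summit.ValiantsHypothesis.ValiantsHypothesis.Theorems.ValuativeFlip
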